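import Summits.BirchSwinnertonDyer.BirchSwinnertonDyer.Theorems.ByReductionTypeAtTwoRankOneAtTwoOneDoorLawSubsliceDefs
import HarnessLib

/-!
# Route ByReductionTypeAtTwo, crux `RankOneAtTwoBigImageOddLocal` (stmt-BirchSwinnertonDyer-23715), LINE v8.17 `one_door_analytic`:
# the FIRST LAYER MADE SIGN-FREE — `HeegnerNonDivisibilityAtSelmerTrivialMinimalDoorAtTwo` (R₀)

Lead prover seat `bsd-line-fkl-p1` g16 (2026-08-28).  Companion of `…OneDoorLawSubsliceDefs.lean` (APPEND #8–#11: the sub-slice split,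
R⁻₀, R₊, R₊₊), as a separate module so that the statements files stay under the size limit.  ONE statement (a `def … : Prop` tagged
`@[conjecture]`); nothing is asserted; BSD is not proved by any of this.

Why.  LINE v8.16 carries the FIRST Kolyvagin layer of the crux as TWO conjecture-grade stubs split by the sign of the discriminant:
R⁻₀ `HeegnerNonDivisibilityAtSelmerTrivialPrimeDoorAtTwo` (`Δ_W < 0`: the Heegner point over a `Sel₂`-trivial TRANSPOSITION-prime door is
not `2`-divisible modulo torsion) and -an's AN-13 `F1Sign2.HeegnerPointOnEggAtTwo` (`Δ_W > 0`: the Heegner point over a desc-admissible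
door of an egg curve is rational-on-the-EGG up to torsion).  Both are ONE statement read at two kinds of minimal door: by the width seat's
dictionary `rationalPointEggKappaIndexDictionaryAtTwo` (AN-34n: «on the egg up to torsion ⟺ `E(ℚ)` meets the egg ∧ exponent `0`») the
archimedean statement AN-13 is, on its class, exactly «exponent `0`», and by route GenusKolyvaginAtTwo's PROVED egg twist law
`GenusKolyArch.eggTwistLawAtTwo_holds` (Kramer 1981 Prop. 6: on a rank-one `Ш[2] = 0` egg curve EVERY desc-admissible twist has `#Sel₂ = 1`)
the egg class is exactly the `Δ_W > 0` locus of `Sel₂`-trivial minimal doors — just as gk2-p4's transposition supply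
(`exists_transpAdmissible_door_twistSelmerTwoCard_eq_one`) makes the R⁻₀ class the `Δ_W < 0` locus.  Hence the sign-free statement
below: **at every `Sel₂`-TRIVIAL MINIMAL door of a `Ш(W)[2] = 0` curve of the slice the Heegner point has exponent `0`** — W. Zhang's theorem
«Kolyvagin's conjecture» (Camb. J. Math. 2 (2014) Thm. 1.1: `Sel_{p}(E/K)` of rank one ⟹ `y_K ∉ pE(K)`; printed for `p ≥ 5`) at `p = 2` in
its `Sel₂`-rank-one instance `Sel₂(E/ℚ) ≅ ℤ/2`, `Sel₂(E^{(d_K)}/ℚ) = 0`, with no condition on the sign of `Δ_W` and no archimedean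
vocabulary.  It implies R⁻₀ verbatim and puts the egg class on the proved sub-slice (`Theorems/…OneDoorSubsliceFirstLayer.lean`), so LINE
v8.17 registers it IN PLACE OF the pair (R⁻₀, AN-13): stubs `stub_pub4` · `stub_pub37` (PRINT) · `stub_kolyvaginTwo` (R₀, this statement) ·
`stub_residuePlusPlus` (R₊₊) · `stub_rankZeroAtTwo` (route items).  Conversely R₀ follows from the crux modulo the rank-`0` `2`-converse for the
`Sel₂`-trivial twin (both signs; the width seat's `…OneDoorSubsliceNegDiscTwoConverse.lean` pattern), and from R⁻₀ ∧ AN-13 modulo print.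

References (locators): W. Zhang, Camb. J. Math. 2 (2014) Thm. 1.1 (p ≥ 5; shape only); Gross 1991 Conj. 1.2, §3, §10; Kolyvagin 1990
Thm. A; Gross–Zagier 1986 Thm. I.6.3 and V.§2; Kramer 1981 Prop. 3 and Prop. 6; Mazur–Rubin 2010 Cor. 3.4 (i).
-/

set_option autoImplicit false

noncomputable section

open scoped Classical

set_option linter.dupNamespace false

namespace Summit.BirchSwinnertonDyer.BirchSwinnertonDyer.Theorems.RankOneAtTwoOneDoor

open Literature.NumberTheory.EllipticCurves Literature.NumberTheory.EllipticCurves.ModularForms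
  Summit.BirchSwinnertonDyer.Rank1Residual.F1Sign2
  Summit.BirchSwinnertonDyer.Rank1Residual.F1Sign2.TranspositionDoor

/-! ### LINE v8.17 (lead prover seat `bsd-line-fkl-p1` g16, 2026-08-28): the sign-free first layer R₀ -/

/-- **R₀ `HeegnerNonDivisibilityAtSelmerTrivialMinimalDoorAtTwo` — KOLYVAGIN'S CONJECTURE AT `2` AT A `Sel₂`-TRIVIAL MINIMAL DOOR
(CONJECTURE; the sign-free first Kolyvagin layer of LINE v8.17, registered stub `stub_kolyvaginTwo` in place of the pair R⁻₀ / AN-13).**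
`W/ℚ` globally minimal, non-CM, `ρ_{W,2^n}` onto for all `n`, odd torsion order, odd Tamagawa product, analytic rank `1`, `Ш(W)[2] = 0`
(`ShaTwoTrivial W`); `K` imaginary quadratic with `d_K` door-admissible (`d_K < 0` square-free, `≡ 1 (8)`, its primes good, a square at the odd
bad primes) and the door MINIMAL (`t + 2s = [Δ_W < 0]`: ONE error place — the transposition prime at `Δ_W < 0`, the real place at
`Δ_W > 0`), `(d_K, N_W) = 1`, the Heegner hypothesis, and the twin `Sel₂`-TRIVIAL: `#Sel₂(W^{(d_K)}/ℚ) = 1`; `Dt` a parametrisation datum of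
level `N_W` with ODD constant, `H`, `ι`, and `P ∈ E(K)` mapping to the complex Heegner point.  THEN `P ∉ 2E(K) + E(K)_tors`
(`HasTwoDivisibilityUpToTorsion W K P 0`).  At `Δ_W < 0` this is R⁻₀ `HeegnerNonDivisibilityAtSelmerTrivialPrimeDoorAtTwo` (whose extra
hypotheses `TranspAdmissible`, `MeetsNonNormAt` refine «door-admissible + minimal»); at `Δ_W > 0` it is -an's AN-13′
`F1Sign2.HeegnerKummerClassNonzeroAtTwo` on the slice (the egg twist law makes every desc-admissible twin of a rank-one `Ш[2] = 0` egg curve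
`Sel₂`-trivial, and `#Sel₂ = 1` forces the egg).  BSD-consistency: the AN-28c identity `2m + [Δ_W < 0] = s_W + s_d + t + 2s + 2·v₂(c)` reads
`2m + [Δ_W < 0] = 0 + 0 + [Δ_W < 0] + 0` here, i.e. `m = 0`.  Why it might fail: it is Kolyvagin's conjecture at the prime `2` (no eigenspace
decomposition of `E[2]` under complex conjugation; Zhang's proof uses level raising and multiplicity one modulo `p ≥ 5`; Kriz–Li 2019 Rem. 1.14:
no `2`-converse of this kind is known for `E[2]` irreducible).  Census: every `m = 0` row of AN-28c's ENGINE L tables with `s_W = s_d = 0` at a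
minimal door (812/812 at `Δ < 0`, lead report G11 §6; the egg rows of -an's AN-10H♯ 4 387/4 387 and T13.2 1 960/1 960 at `Δ > 0`); the door
exists for every curve of either class (gk2-p4 `exists_transpAdmissible_door_twistSelmerTwoCard_eq_one`, gk2 `exists_silent_prime_heegnerField`
+ `eggTwistLawAtTwo_holds`; unconditional). [cite: Zhang2014CJM, Thm. 1.1 (p ≥ 5; shape only; nothing asserted)]
[cite: GrossLMS1991, Conj. 1.2, §3 and §10] [cite: Kolyvagin1990, Thm. A] [cite: Kramer1981, Prop. 3 and Prop. 6] -/
@[conjecture] def HeegnerNonDivisibilityAtSelmerTrivialMinimalDoorAtTwo : Prop :=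
  ∀ (W : WeierstrassCurve ℚ) [W.IsElliptic] [W.IsGloballyMinimal] [NeZero (W.conductorNorm ℤ)],
    ¬ W.HasCM → (∀ n : ℕ, W.HasSurjectiveModNGaloisRep ((2 ^ n : ℕ) : ℤ)) → Odd W.torsionOrder → Odd W.tamagawaProduct →
    W.analyticRank = 1 → ShaTwoTrivial W →
    ∀ (K : Type) [Field K] [NumberField K], IsImaginaryQuadratic K →
      DoorAdmissible W (NumberField.discr K) →
      transpCount W (NumberField.discr K) + 2 * identCount W (NumberField.discr K) = (if W.Δ < 0 then 1 else 0) →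
      Nat.Coprime (NumberField.discr K).natAbs (W.conductorNorm ℤ) → SatisfiesHeegnerHypothesis (W.conductorNorm ℤ) K →
      twistSelmerTwoCard W (NumberField.discr K) = 1 →
      ∀ (Dt : ModularParametrizationData W (W.conductorNorm ℤ))
        (H : HeegnerDatum (W.conductorNorm ℤ) (NumberField.discr K)) (ι : K →+* ℂ)
        (P : (W.baseChange K).toAffine.Point),
        WeierstrassCurve.Affine.Point.map ι.toRatAlgHom P = heegnerPointComplex Dt H → Odd Dt.c →
        HasTwoDivisibilityUpToTorsion W K P 0

/-! ### APPEND #2 (lead prover seat `bsd-line-fkl-p1` g16, 2026-08-28) — LINE v8.17 final form: the FLOATING-EXPONENT first layer R₀⁺ (Manin-free)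
and the two residues off the first-layer locus, R_S and R_N, BY NAME

Why.  R₀ above fixes an ODD-constant datum to set `v₂(c) = 0`; the curves of the first-layer locus WITHOUT an odd-constant datum (the `2`-primary Manin
question at `4 ∣ N_W`) then fall into the residue R₊₊ as a third «population» (the width seat fkl-p2 g14's R_A in `…OneDoorSubsliceResiduePlusPlusSplit.lean`).
But the parametrisation constant is NOT an input of `BSD₂` (the v8.4 insight; fkl-p2 g14's `…OneDoorSubsliceNegDiscFloat.lean`: the door identity is
datum-covariant, `φ_D = nφ₁ ⇒ P_D = nP₁, c_D = nc₁`): at a `Sel₂`-trivial minimal door of a `Ш(W)[2] = 0` curve the AN-28c identity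
`2m + [Δ_W<0] = s_W + s_d + t + 2s + 2·v₂(c)` reads `m = v₂(c)` for EVERY datum.  So the first layer is registered with a FLOATING exponent (R₀⁺ below,
sign-free; = fkl-p2's sign-split R⁻_float / R⁺_float in one statement), which makes EVERY curve of the locus {`Ш(W)[2] = 0`, `Δ_W < 0 ∨ MeetsEgg W`} lawful
with NO odd-constant hypothesis, NO `S_manin` / `ManinOddAdditiveLevelAtTwo` / `S_maninPub`, and NO bottom rung U₀ (hence no Gross 1991 Prop. 3.7 (2)) on the
composition path; what is left off the locus is exactly two single-mechanism residues, R_S (`Ш(W)[2] ≠ 0`: Kolyvagin exactness at `2` beyond the first layer,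
route GenusKolyvaginAtTwo 24882) and R_N (`Δ_W > 0`, `Ш(W)[2] = 0`, `E(ℚ) ⊂ E⁰(ℝ)`: the non-egg residual, 24883 / -an's `η_f = 0`), whose bodies below are
VERBATIM the hypotheses `hS` / `hN` of fkl-p2 g14's `doorIndexLawFullCAtTwoSomeDoorResiduePlusPlus_of_populations`.  Skeleton v8.17: `stub_pub4` (PRINT ×4) ·
`stub_heegnerExponent : S_pub4 → HeegnerExponentAtSelmerTrivialMinimalDoorAtTwo` · `stub_residueSha : S_pub4 → DoorIndexLawFullCAtTwoSomeDoorResidueSha` ·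
`stub_residueNonEgg : S_pub4 → DoorIndexLawFullCAtTwoSomeDoorResidueNonEgg` · `stub_rankZeroAtTwo`; composition `Theorems/…OneDoorSubsliceFirstLayerManinFree.lean`.
Nothing is asserted; BSD is not proved by any of this. -/

/-- **R₀⁺ `HeegnerExponentAtSelmerTrivialMinimalDoorAtTwo` — KOLYVAGIN'S CONJECTURE AT `2` WITH FLOATING EXPONENT (CONJECTURE; the sign-free, Manin-free first
Kolyvagin layer of LINE v8.17, registered stub `stub_heegnerExponent`).**  `W/ℚ` globally minimal, non-CM, `ρ_{W,2^n}` onto for all `n`, odd torsion order, odd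
Tamagawa product, analytic rank `1`, `Ш(W)[2] = 0`; `K` imaginary quadratic with `d_K` door-admissible and the door MINIMAL (`t + 2s = [Δ_W < 0]`), `(d_K, N_W) = 1`,
the Heegner hypothesis, `#Sel₂(W^{(d_K)}/ℚ) = 1`; `Dt` ANY parametrisation datum of level `N_W` (constant `c`), `H`, `ι`, and `P ∈ E(K)` over the complex Heegner
point.  THEN the exact `2`-divisibility exponent of `P` modulo torsion is `v₂(c)` (`HasTwoDivisibilityUpToTorsion W K P (padicValInt 2 Dt.c)`).  Its odd-`c` face
is R₀ `HeegnerNonDivisibilityAtSelmerTrivialMinimalDoorAtTwo` (`heegnerNonDivisibilityMinimalDoor_of_heegnerExponent`); it is AN-28c `DoorIndexLawFullCAtTwo`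
restricted to the first-layer locus (`s_W = s_d = 0`, `t + 2s = [Δ_W<0]`), i.e. W. Zhang 2014 Thm. 1.1 at `p = 2` in the `Sel₂`-rank-one instance, for every
parametrisation.  BSD-consistency: the per-datum kernel iff `bsdp_two_iff_doorLawFullC_at_of_rank` gives exactly `m = v₂(c)` from `BSDp W 2` here.  Why it might
fail: Kolyvagin's conjecture at the prime `2`; for `v₂(c) > 0` additionally the `2`-power divisibility of the Heegner point of a non-optimal / even-constant
parametrisation (`P_D = nP₁`-covariance makes the optimal datum decisive).  Census: as R₀ (ENGINE L rows are optimal data, `v₂(c) = 0`); no certified row with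
`v₂(c) > 0` (Cremona: Manin constant `1` throughout the tables). [cite: Zhang2014CJM, Thm. 1.1 (p ≥ 5; shape only; nothing asserted)]
[cite: GrossLMS1991, Conj. 1.2, §3 and §10] [cite: GrossZagier1986, Thm. I.6.3 and V.§2] [cite: Kramer1981, Prop. 3 and Prop. 6] -/
@[conjecture] def HeegnerExponentAtSelmerTrivialMinimalDoorAtTwo : Prop :=
  ∀ (W : WeierstrassCurve ℚ) [W.IsElliptic] [W.IsGloballyMinimal] [NeZero (W.conductorNorm ℤ)],
    ¬ W.HasCM → (∀ n : ℕ, W.HasSurjectiveModNGaloisRep ((2 ^ n : ℕ) : ℤ)) → Odd W.torsionOrder → Odd W.tamagawaProduct →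
    W.analyticRank = 1 → ShaTwoTrivial W →
    ∀ (K : Type) [Field K] [NumberField K], IsImaginaryQuadratic K →
      DoorAdmissible W (NumberField.discr K) →
      transpCount W (NumberField.discr K) + 2 * identCount W (NumberField.discr K) = (if W.Δ < 0 then 1 else 0) →
      Nat.Coprime (NumberField.discr K).natAbs (W.conductorNorm ℤ) → SatisfiesHeegnerHypothesis (W.conductorNorm ℤ) K →
      twistSelmerTwoCard W (NumberField.discr K) = 1 →
      ∀ (Dt : ModularParametrizationData W (W.conductorNorm ℤ))
        (H : HeegnerDatum (W.conductorNorm ℤ) (NumberField.discr K)) (ι : K →+* ℂ)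
        (P : (W.baseChange K).toAffine.Point),
        WeierstrassCurve.Affine.Point.map ι.toRatAlgHom P = heegnerPointComplex Dt H →
        HasTwoDivisibilityUpToTorsion W K P (padicValInt 2 Dt.c)

/-- **R₀⁺ ⟹ R₀** (the odd-constant face: `v₂(c) = 0` for odd `c`).  Import-free bookkeeping. [cite: Zhang2014CJM, Thm. 1.1] [cite: GrossLMS1991, Conj. 1.2] -/
theorem heegnerNonDivisibilityMinimalDoor_of_heegnerExponent (h : HeegnerExponentAtSelmerTrivialMinimalDoorAtTwo) :
    HeegnerNonDivisibilityAtSelmerTrivialMinimalDoorAtTwo := by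
  intro W _ _ _ hCM hsurj hT hc hr hSha K _ _ hK hadm hmin hcop hHN hsel Dt H ι P hP hodd
  have hc2 : ¬ (2 : ℤ) ∣ Dt.c := fun h2 => Int.not_even_iff_odd.mpr hodd (even_iff_two_dvd.mpr h2)
  have h0 : padicValInt 2 Dt.c = 0 := padicValInt.eq_zero_of_not_dvd hc2
  have hm := h W hCM hsurj hT hc hr hSha K hK hadm hmin hcop hHN hsel Dt H ι P hP
  rwa [h0] at hm

/-- **R_S `DoorIndexLawFullCAtTwoSomeDoorResidueSha` — THE RESIDUE ON `Ш(W)[2] ≠ 0` (CONJECTURE; «24882-type»: Kolyvagin exactness at `2` BEYOND the first layer;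
registered stub `stub_residueSha` of LINE v8.17).**  Every curve of the slice (`W` globally minimal, non-CM, `ρ_{W,2^n}` onto, odd torsion order, odd Tamagawa
product, analytic rank `1`) with `Ш(W)[2] ≠ 0` admits a LAWFUL door datum (`HasLawfulDoorAtTwo W`: some non-vanishing admissible door datum and exponent with
`2m + [Δ_W<0] = s_W + s_d + t + 2s + 2·v₂(c)`; here `s_W ≥ 2`, so `m ≥ 1` at every minimal door).  VERBATIM the hypothesis `hS` of the width seat fkl-p2 g14's
`doorIndexLawFullCAtTwoSomeDoorResiduePlusPlus_of_populations` (`Theorems/…OneDoorSubsliceResiduePlusPlusSplit.lean`); the residue's `¬HasBottomRungDoorAtTwo W` is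
automatic here modulo print (`not_hasBottomRungDoorAtTwo_of_not_shaTwoTrivial`).  Why it might fail: it is `BSD₂` in Heegner-index currency for the rank-one
slice curves with `Ш[2] ≠ 0` — the second and higher Kolyvagin layers at `p = 2` (route GenusKolyvaginAtTwo's structure theorem 24882; no printed instance at `2`).
Census: AN-28c's ENGINE L rows with `s_W > 0` (j300076 + j303912). [cite: GrossLMS1991, Conj. 1.2, §3 and §10] [cite: Kolyvagin1990, Thm. A]
[cite: GrossZagier1986, Thm. I.6.3 and V.§2] -/
@[conjecture] def DoorIndexLawFullCAtTwoSomeDoorResidueSha : Prop :=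
  ∀ (W : WeierstrassCurve ℚ) [W.IsElliptic] [W.IsGloballyMinimal] [NeZero (W.conductorNorm ℤ)],
    ¬ W.HasCM → (∀ n : ℕ, W.HasSurjectiveModNGaloisRep ((2 ^ n : ℕ) : ℤ)) → Odd W.torsionOrder → Odd W.tamagawaProduct →
    W.analyticRank = 1 → ¬ ShaTwoTrivial W → HasLawfulDoorAtTwo W

/-- **R_N `DoorIndexLawFullCAtTwoSomeDoorResidueNonEgg` — THE RESIDUE ON THE `Δ_W > 0` NON-EGG LOCUS (CONJECTURE; «24883-type» / -an's `η_f = 0`; registered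
stub `stub_residueNonEgg` of LINE v8.17).**  Every curve of the slice with `Δ_W > 0`, `Ш(W)[2] = 0` and `E(ℚ) ⊂ E⁰(ℝ)` (`¬ MeetsEgg W`) admits a LAWFUL door
datum.  VERBATIM the hypothesis `hN` of fkl-p2 g14's `doorIndexLawFullCAtTwoSomeDoorResiduePlusPlus_of_populations`; `¬HasBottomRungDoorAtTwo W` is automatic
modulo print (`not_hasBottomRungDoorAtTwo_of_not_meetsEgg`).  Here every desc-admissible twin has `#Sel₂ = 4` (egg twist law) and every door has `t` even, so
`m ≥ 1` at every door: again a statement beyond the first layer.  Why it might fail: as R_S.  Census: AN-28c's rows with `Δ > 0` and egg bit `0`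
(ENGINE L; -an ENGINE E/HC). [cite: GrossLMS1991, Conj. 1.2, §3 and §10] [cite: Kramer1981, Prop. 6] [cite: Kolyvagin1990, Thm. A] -/
@[conjecture] def DoorIndexLawFullCAtTwoSomeDoorResidueNonEgg : Prop :=
  ∀ (W : WeierstrassCurve ℚ) [W.IsElliptic] [W.IsGloballyMinimal] [NeZero (W.conductorNorm ℤ)],
    ¬ W.HasCM → (∀ n : ℕ, W.HasSurjectiveModNGaloisRep ((2 ^ n : ℕ) : ℤ)) → Odd W.torsionOrder → Odd W.tamagawaProduct →
    W.analyticRank = 1 → 0 < W.Δ → ShaTwoTrivial W → ¬ MeetsEgg W → HasLawfulDoorAtTwo W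

/-- **The hypothesis-free form gives both residues** (drop hypotheses): `DoorIndexLawFullCAtTwoSomeDoor ⟹ R_S ∧ R_N`.  Import-free bookkeeping (used for
losslessness: the crux gives `DoorIndexLawFullCAtTwoSomeDoor` modulo print, `doorIndexLawFullCAtTwoSomeDoor_of_rankOneAtTwoBigImageOddLocal`).
[cite: GrossLMS1991, Conj. 1.2 and §3] -/
theorem residueSha_and_residueNonEgg_of_someDoor (h : DoorIndexLawFullCAtTwoSomeDoor) :
    DoorIndexLawFullCAtTwoSomeDoorResidueSha ∧ DoorIndexLawFullCAtTwoSomeDoorResidueNonEgg :=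
  ⟨fun W _ _ _ hCM hsurj hT hc hr _ => h W hCM hsurj hT hc hr,
    fun W _ _ _ hCM hsurj hT hc hr _ _ _ => h W hCM hsurj hT hc hr⟩

end Summit.BirchSwinnertonDyer.BirchSwinnertonDyer.Theorems.RankOneAtTwoOneDoor

end
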